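import Summits.BirchSwinnertonDyer.Rank1Residual.X12.InertCoreManinFree
import Summits.BirchSwinnertonDyer.Rank1Residual.X12.InertBadLocalTypes
import Literature.NumberTheory.EllipticCurves.CanonicalPAdicHeightThetaProofs
import HarnessLib

/-!
# Class X12, residual class O10 (CM, `r_an = 1`, `p ≥ 5` INERT in the CM field and BAD): the
# CLASS-CLOSURE typed layer — signed local types and the class target PER LOCAL TYPE, with the
# status of Rubin's `η`-branch after Burungale–Kobayashi–Nakamura–Ota 2025
# (cell `b2b-bsdres`, lane CLASS-CLOSURE §3.14, seat `cc-typer-6`; v2)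

HONEST FRAMING (run/shared/lean/b2b/bsd-rank1-residual/, verbatim in every file): the goal of the
cell is to DELETE the COMBINATION-SHAPED residual classes of the Birch–Swinnerton-Dyer formula for
ALL analytic-rank `≤ 1` elliptic curves over `ℚ` — "full BSD formula for every rank `≤ 1` curve in
class `C`" assembled STRICTLY from published theorems — so that the rank-`≤ 1` remainder becomes
exactly the CONSTRUCTION-SHAPED classes, which are TYPED (missing-input `Prop`s), NOT attempted.
This is not "finishing BSD". Research route; NO CLAIM BEYOND STATED CLASSES; X12 / O10 stay
CONSTRUCTION-SHAPED and OPEN; nothing here changes a label or a mark; census / instrument output is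
EVIDENCE, never a Literature fact. Definitions = one tree-vocabulary predicate and ONE `@[conjecture]`
statement (NOTHING asserted); theorems = bookkeeping over the tree's existing theorems and its
PUBLISHED named facts BY NAME (binders `hGZ`, `hKo`, `hMN`, `hGZK`, `hmod`, `hnf`, `hFH`, `hCM8`
exactly as in `X12/InertCoreStepL.lean`). No new named fact.

v2 (same seat, same generation): v1 of this file also typed the finite-check shadows `(R1_η)` /
`(R2_η)` of Rubin's `𝒫_+` / `𝒫_−` and a criterion-shaped formulation `RubinEtaCriterionAt`
("witnesses ⇒ target", after Rubin 1987 Thm. 8.4). They are WITHDRAWN here — kept verbatim as tombstones at the end of the file, docstrings marked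
WITHDRAWN (the tree is append-only; nothing references them): rmap-3 gen 7's CORRECTION (HOME INBOX 06:3xZ) — the
LOCAL half of the `η`-branch is a theorem of a 2025 preprint (below), so a Rubin-type criterion for
it is moot, exactly as Thm. 8.4 became moot on the `ω`-branch after Burungale–Kobayashi–Ota 2021;
the witness tables stay EVIDENCE in the class folder (HOME `class-closure/O10/TYPED-typer6.md`).

## What is typed here and why (CLASS-CLOSURE deliverables (a)/(b)/(c) for O10)

**(b) SUB-PARTITION.** O10 = `ClassX12 W p ∧ 5 ≤ p ∧ CMInert W p` (then `p ∣ N`, additive,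
potentially supersingular). The class lead's E2 anatomy (x1b gen 23, HOME
`b2b-bsdres-x1b/gen23/O10-TARGET.md` §§0–2, §7; kernel `X12/InertBadKodairaTypes.lean`,
`X12/InertBadLocalTypes.lean`) shows that the ONE hypothesis of the inert-prime CM programme
(Rubin 1987 → Rubin 1991 → Agboola–Howard → Burungale–Kobayashi–Ota 2021/2024 → Yan–Zhu 2025) that
fails on O10 is "good reduction at `p`" — structurally: Rubin's module of local units is the
`ω = κ|_Δ`-eigenspace of `Δ = Gal(Φ₀/Φ) ≅ 𝔽_{p²}^×` [Rubin 1987 §1 p. 406], while an inert-BAD CM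
curve `E = A ⊗ χ` (tame twist of order `e ∈ {2,3,4,6}`, `e ∣ p + 1`, of a CM curve `A` GOOD at `p`)
lives on the `η = ω·χ_p`-eigenspace. The local datum `χ_p` is read off the Kodaira symbol at `p`
(`I₀* ↦ e = 2`; `IV, IV* ↦ 3`; `III, III* ↦ 4`; `II, II* ↦ 6`; a symbol and its star are the two
conjugate characters). Hence the sub-partition of O10 is BY SIGNED LOCAL TYPE `(p, T)`,
`T : KodairaSymbol` — `HasSignedLocalType W p T` below (tree atoms only: `HasCM`, `CMInert`, `Good`,
`kodairaSymbolAt`); `signedLocalType_cases` lists the admissible `T` (from x1b's theorem). Census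
(EVIDENCE): 995 inert-bad pairs `N < 5·10⁵` in 72 local problems `(p, e)` over 29 primes `p ≤ 173`,
the 146 O10/O11 residue cells of R196.10 in 33 (x1b `gen23/e2/O10-O11-SUBPARTITION.tsv`).

**(a) STATEMENT.** No census object exists for O10 (no engine at an additive CM prime — PARI's
`ellpadicL` refuses it; ttrl2, CLASS-CLOSURE-PLAN §3.14), so there is no fitted relation to type. The
class target restricted to one signed local type is typed as `LowerHalfOnType p T` (`@[conjecture]`,
label OBJECT): `MissingLowerBoundAt` (`ord_p #Ш_an ≤ ord_p #Ш`) for EVERY CM curve of type `(p, T)`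
with `r_an = 1`. With the tree's X12 theorems this IS `BSD(E,p)` on that sub-class modulo the Manin
datum (`bsdp_of_lowerHalfOnType`; Manin-free for the strong curve at `p ≥ 11`,
`bsdp_of_lowerHalfOnType_of_optimal`; converse `lowerHalfOnType_of_forall_bsdp`). STATUS OF THE
`η`-BRANCH, read from the sources (x1b gen 23; rmap-3 gen 7 primary read of Rubin 1987, HOME
`b2b-bsdres-rmap-3/g7/rubin1987/RUBIN1987-READ.md`, and its 06:3xZ correction):
* LOCAL half — the `η`-analogue of Rubin's Conjecture 2.2 [Rubin 1987 p. 408: `V⁺ ≅ V⁻ ≅ Λ`,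
  `V_∞ = V⁺ ⊕ V⁻`, stated on the `ω`-eigenspace for curves GOOD above `p ≥ 5`; proved there by
  Burungale–Kobayashi–Ota 2021, at `p = 3` by Yan–Zhu 2025]: for `K` the UNRAMIFIED quadratic
  extension of `ℚ_p`, `p` odd, and a conjugate symplectic self-dual character `φ = φ_π·η` of
  Hodge–Tate weights `(1, 0)` with finite part `η` of ANY conductor (tame `η`: "remains true for all
  characters `χ`"), the signed submodules `H¹_±(K, 𝕋_φ)` are free of rank one, Lagrangian, and
  `H¹ = H¹₊ ⊕ H¹₋` — Burungale–Kobayashi–Nakamura–Ota, arXiv:2508.17776 (2025), Thm. 2.25 / Thm. 2.29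
  (PREPRINT; proof by local `ε`-constants, bypassing the four places where Rubin's 1987 argument is
  not eigenspace-generic: pp. 406/407, 408–409, 414–415, 417). On every O10 pair the local character
  is `φ_π·η` with `η` TAME (`e ∣ p + 1`, `p ∤ e`), so this covers the local half — at preprint tier.
* GLOBAL half — an integral `p`-adic `L`-function and a main conjecture on the `η`-branch
  ("generalizing … [BKO21] to the non-semistable reduction case") are ANNOUNCED only
  [BKNO 2025 Rem. 2.31, no statement]; Rubin 1991's two-variable main conjecture covers the branch
  `ψ_E = ψ_A·χ` verbatim (x1b O10-TARGET §1 (v)); the leading-term / `p`-adic Gross–Zagier link on the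
  branch (Rubin's formula, Burungale–Kobayashi–Ota 2024 Thm. 1.1 at GOOD `p`) is in NO source — open
  claim for `e = 2`, `j = 1728` attributed to Pan 2017 [Tian, Proc. ICM 2022, p. 1993; substitute
  source, acq-08479].
So the irreducible residue of O10 named for IDEATION is: the `η`-branch main conjecture (announced)
+ the `η`-branch leading-term formula (unprinted) ⇒ `LowerHalfOnType p T` for each of the ≤ 4 local
problems per prime. EVIDENCE in the class folder (x1b gen 24 LUNIT / LOCDIV, two engines
14 506/14 506; `class-closure/O10/E4-LOCDIV.md`): per signed type, rank-`0` CM curves with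
`p`-adic-unit `#Ш_an` and rank-`1` CM curves with a locally `p`-indivisible point exist throughout
Cremona's range; every O10 cell there has `ord_p #Ш_an = 0` and closes PER PAIR (T-KR / T-MN19) —
consistent with `LowerHalfOnType` wherever checked; nothing computes the `η`-branch `L`-function.

**(c) TRANSPORT.** x1b's E3 verdict (O10-TARGET §3) stands and needs no declaration: isogeny is
class-internal (Cassels; `X12/CMIsogenyInvariance.lean`); the tame twist `E = A ⊗ χ` relates every
O10 pair to an inert-GOOD CM curve `A` (COVERED row C10 / T17 when `r_an(A) ≤ 1`), and the
comparison statement that transport would need — "`BSD_p` along a tame anticyclotomic twist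
ramified at `p`" — IS `LowerHalfOnType` (the class theorem itself); quadratic-twist relocation for
`e = 2` lands at a ramified supersingular prime over a real quadratic field (no `p`-adic
Gross–Zagier there); cc-eng-3's `O10/twist-orbit-cm.tsv` confirms per cell that a twist partner
CLOSED and GOOD at `p` exists for 146/146 cells — a relation WITHOUT a transport lemma.

References: [Rubin1987LocalUnits] §1 p. 406, §2 pp. 407–408 (Conj. 2.2), §3 pp. 408–409, §6
pp. 414–415, §7 p. 417, §8 p. 418 (Thm. 8.4), §10 pp. 420–421; [BurungaleKobayashiOta2021]
(Conj. 2.2, `ω`-eigenspace, `p ≥ 5`); [BurungaleKobayashiOta2023] §2.1.1, §3.0.1 (good reduction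
at `p` enters to identify `Ê` with the Lubin–Tate group), Thm. 1.1; [YanZhu2025] Thm. 1.1 (`p = 3`);
[BurungaleKobayashiNakamuraOta2025] Thm. 2.25, Thm. 2.29, Rem. 2.31 (PRE);
[Tian2023CongruentICM] p. 1993; [Miller2011LMS] Def. 1.1; [SilvermanATAEC1994] IV.9.4 Table 4.1.
-/

noncomputable section

open scoped Classical NumberField

open WeierstrassCurve NumberField IsDedekindDomain IsDedekindDomain.HeightOneSpectrum
  Rat.HeightOneSpectrum Literature.NumberTheory.EllipticCurves
  Literature.NumberTheory.EllipticCurves.ModularForms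
  Literature.NumberTheory.EllipticCurves.Rank1Residual
  Literature.NumberTheory.EllipticCurves.Rank1Residual.Typed
  Literature.NumberTheory.Automorphic
  Literature.NumberTheory.DiophantineGeometry

namespace Summit.BirchSwinnertonDyer.Rank1Residual.X12.O10

/-! ### (b) The signed local type of a CM curve at an inert prime -/

/-- **Signed local type `(p, T)`.** `W/ℚ` has CM, `p` is INERT in the CM field (neither ramified nor
split, `CMInert`), `W` is BAD at `p`, and the Kodaira symbol at the place of `ℚ` over `p` is `T`.
For `p ≥ 5` this fixes the tame character `χ_p : Gal(Φ₀/Φ) → μ_e` of the pair (`e` = semistability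
defect: `I₀* ↦ 2`, `IV/IV* ↦ 3`, `III/III* ↦ 4`, `II/II* ↦ 6`; a symbol and its star are conjugate
characters), i.e. the eigenspace `η = ω·χ_p` on which the pair's local Iwasawa theory lives
(x1b O10-TARGET §1 (iii)). A predicate; any rank. [cite: SilvermanATAEC1994, IV.9.4 and Table 4.1]
[cite: Rubin1987LocalUnits, §1 (p. 406)] -/
def HasSignedLocalType (W : WeierstrassCurve ℚ) [W.IsElliptic] (p : ℕ) [Fact p.Prime]
    (T : KodairaSymbol) : Prop :=
  W.HasCM ∧ CMInert W p ∧ ¬ Good W p ∧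
    ∀ v : HeightOneSpectrum (𝓞 ℚ), natGenerator v = p → W.kodairaSymbolAt v = T

/-! ### (a) The class target per signed local type -/

/-- **O10 restricted to the signed local type `(p, T)`** (label OBJECT — the class target itself,
OPEN): for EVERY CM curve `W/ℚ` of signed local type `(p, T)` with `r_an(W) = 1`, the lower half
`ord_p #Ш(W)_an ≤ ord_p #Ш(W)` (`MissingLowerBoundAt`, the "main-conjecture direction"; the upper
half is a theorem of the published record on the core, `X12/InertCoreUpperHalf.lean`). This is what
the `η`-branch of the inert-prime CM programme would deliver. Its LOCAL half (the `η`-analogue of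
Rubin's Conjecture 2.2 [p. 408], proved on `ω` for `p ≥ 5` by Burungale–Kobayashi–Ota 2021 and at
`p = 3` by Yan–Zhu 2025, both for curves GOOD at `p`) is Burungale–Kobayashi–Nakamura–Ota 2025
Thm. 2.25 / 2.29 (PREPRINT: `K` the unramified quadratic extension of `ℚ_p`, `p` odd, finite part
`η` of any conductor, tame `η` for all `χ`); its GLOBAL half — an integral `p`-adic `L`-function and
main conjecture "in the non-semistable reduction case" — is ANNOUNCED only (loc. cit. Rem. 2.31),
Rubin 1991's main conjecture covers the branch, and the leading-term formula on the branch
(Burungale–Kobayashi–Ota 2024 Thm. 1.1 at good `p`) is in NO source; open claim for `e = 2`,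
`j = 1728` attributed to Pan 2017 [Tian ICM 2022 p. 1993, substitute source]. Nothing asserted.
[cite: Rubin1987LocalUnits, §2 Conjecture 2.2 (p. 408) and §10 (pp. 420–421)]
[claim: BurungaleKobayashiNakamuraOta2025, status: under-review]
[cite: BurungaleKobayashiOta2023, §3.0.1 (good reduction at p: Ê ≅ the Lubin–Tate group) and Thm. 1.1]
[cite: Tian2023CongruentICM, p. 1993] [cite: Miller2011LMS, Def. 1.1] -/
@[conjecture] def LowerHalfOnType (p : ℕ) [Fact p.Prime] (T : KodairaSymbol) : Prop :=
  ∀ (W : WeierstrassCurve ℚ) [W.IsElliptic] [W.IsGloballyMinimal],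
    HasSignedLocalType W p T → W.analyticRank = 1 → MissingLowerBoundAt W p

/-! ### Bookkeeping: membership, admissible symbols, and the consumers -/

section Membership

variable (W : WeierstrassCurve ℚ) [W.IsElliptic] (p : ℕ) [hp : Fact p.Prime] {T : KodairaSymbol}

/-- A rank-one curve of a signed local type at `p` is an X12 pair at `p` (CM, `r_an = 1`, bad at `p`).
Unfolding. [cite: Miller2011LMS, Def. 1.1] -/
theorem classX12_of_hasSignedLocalType (hT : HasSignedLocalType W p T) (hr : W.analyticRank = 1) :
    ClassX12 W p :=
  ⟨hT.1, hr, Or.inr (Or.inr (Or.inr hT.2.2.1))⟩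

/-- … at a prime not ramified in the CM field. Unfolding. [folklore] -/
theorem not_cmRamified_of_hasSignedLocalType (hT : HasSignedLocalType W p T) : ¬ CMRamified W p :=
  hT.2.1.1

/-- … and not split in the CM field. Unfolding. [folklore] -/
theorem not_cmSplit_of_hasSignedLocalType (hT : HasSignedLocalType W p T) : ¬ CMSplit W p :=
  hT.2.1.2

/-- **The admissible signed local types at an inert `p ≥ 5`** (x1b gen 23's Kodaira classification
`hasGoodReductionAt_or_kodairaSymbolAt_of_hasCM`, restated on the predicate; ANY rank):
`j = 0`, `p ≡ 2 (mod 3)`, `T ∈ {II, IV, I₀*, IV*, II*}`; or `j = 1728`, `p ≡ 3 (mod 4)`,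
`T ∈ {III, I₀*, III*}`; or `j ∉ {0, 1728}` and `T = I₀*`. In particular at most seven signed types
(four local problems `e ∈ {2,3,4,6}`) per prime. [cite: SilvermanATAEC1994, IV.9.4, Table 4.1 and App. A §3]
[cite: Cox2013, Prop. 5.16 and Cor. 5.17] -/
theorem signedLocalType_cases (hT : HasSignedLocalType W p T) (hp5 : 5 ≤ p)
    (v : HeightOneSpectrum (𝓞 ℚ)) (hv : natGenerator v = p) :
    (W.j = 0 ∧ p % 3 = 2 ∧ (T = .II ∨ T = .IV ∨ T = .Istar 0 ∨ T = .IVstar ∨ T = .IIstar)) ∨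
      (W.j = 1728 ∧ p % 4 = 3 ∧ (T = .III ∨ T = .Istar 0 ∨ T = .IIIstar)) ∨
      (W.j ≠ 0 ∧ W.j ≠ 1728 ∧ T = .Istar 0) := by
  obtain ⟨hCM, hin, hbad, hk⟩ := hT
  have hkT : W.kodairaSymbolAt v = T := hk v hv
  have hbad' : ¬ W.HasGoodReductionAt v := by
    rw [← hasGoodReductionAtPrime_iff_hasGoodReductionAt_ringOfIntegers v W]
    subst hv
    exact hbad
  subst hv
  rcases hasGoodReductionAt_or_kodairaSymbolAt_of_hasCM W hCM v hp5 hin.1 with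
    h | ⟨hj, hk'⟩ | ⟨hj, hk'⟩ | ⟨hj0, hj1, hk'⟩
  · exact absurd h hbad'
  · refine Or.inl ⟨hj, (cmInert_iff_mod_three_eq_two_of_j_eq_zero W (natGenerator v) (by omega)
      (by omega) hj).mp hin, ?_⟩
    simpa only [hkT] using hk'
  · refine Or.inr (Or.inl ⟨hj, (cmInert_iff_mod_four_eq_three_of_j_eq_1728 W (natGenerator v)
      (by omega) hj).mp hin, ?_⟩)
    simpa only [hkT] using hk'
  · exact Or.inr (Or.inr ⟨hj0, hj1, by simpa only [hkT] using hk'⟩)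

end Membership

section Consumers

variable {p : ℕ} [hp : Fact p.Prime] {T : KodairaSymbol}

/-- Read-off of the class target at one pair of the type. Bookkeeping. [cite: Miller2011LMS, Def. 1.1] -/
theorem missingLowerBoundAt_of_lowerHalfOnType (h : LowerHalfOnType p T) (W : WeierstrassCurve ℚ)
    [W.IsElliptic] [W.IsGloballyMinimal] (hT : HasSignedLocalType W p T) (hr : W.analyticRank = 1) :
    MissingLowerBoundAt W p :=
  h W hT hr

/-- **`LowerHalfOnType p T` ⟹ `BSD(E,p)` for every rank-one CM curve of signed local type `(p, T)`,
`p ≥ 5`, modulo the Manin datum `p ∤ c(D)`** — x1b gen 9/10's upper half and assembly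
(`bsdp_of_classX12_of_not_cmRamified_of_lower`: Kolyvagin in Matar–Nekovář's irreducible form over a
Friedberg–Hoffstein field, Gross–Zagier, GZK, modularity, the CM rank-`0` triple C8; `p ∤ ∏c` is
class-wide by `not_dvd_tamagawaProduct_of_hasCM`). CONDITIONAL on the typed target; nothing booked.
[cite: MatarNekovar2019, Thm. 0.3 and §0.11] [cite: Miller2011LMS, §1 and Def. 1.1] -/
theorem bsdp_of_lowerHalfOnType
    (hGZ : ∀ (N : ℕ) [NeZero N] (W : WeierstrassCurve ℚ) (K : Type) [Field K] [NumberField K],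
      gross_zagier N W K)
    (hKo : ∀ (N : ℕ) [NeZero N] (W : WeierstrassCurve ℚ) (K : Type) [Field K] [NumberField K],
      kolyvagin N W K)
    (hMN : ∀ (N : ℕ) [NeZero N] (W : WeierstrassCurve ℚ) (K : Type) [Field K] [NumberField K],
      MatarNekovar2019.thm03_padicValNat_card_sha_le_of_irreducible N W K)
    (hGZK : rank_eq_analyticRank_of_analyticRank_le_one) (hmod : hasEntireLFunction_rat)
    (hnf : exists_isNewformOf) (hFH : friedbergHoffstein_exists_heegnerField_split_twist_ne_zero)
    (hCM8 : bsdTriple_of_hasCM_of_L_one_ne_zero)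
    (h : LowerHalfOnType p T)
    (W : WeierstrassCurve ℚ) [W.IsElliptic] [W.IsGloballyMinimal] [NeZero (W.conductorNorm ℤ)]
    (hT : HasSignedLocalType W p T) (hr : W.analyticRank = 1) (hp5 : 5 ≤ p)
    (D : ModularParametrizationData W (W.conductorNorm ℤ)) (hc : ¬ (p : ℤ) ∣ D.c) : BSDp W p :=
  bsdp_of_classX12_of_not_cmRamified_of_lower hGZ hKo hMN hGZK hmod hnf hFH hCM8 W p
    (classX12_of_hasSignedLocalType W p hT hr) hp5 (not_cmRamified_of_hasSignedLocalType W p hT) D hc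
    (not_dvd_tamagawaProduct_of_hasCM W hT.1 p hp5) (h W hT hr)

/-- **The same for the STRONG (optimal) curve at `p ≥ 11`, with NO Manin datum** (x1b gen 11's
`bsdp_of_classX12_of_cmInert_of_optimal_of_lower`: Edixhoven's `p ∤ c` off potentially good
ordinary primes + Deuring). CONDITIONAL on the typed target; nothing booked.
[cite: EdixhovenManin1991, Thm. 3] [cite: MatarNekovar2019, Thm. 0.3 and §0.11] -/
theorem bsdp_of_lowerHalfOnType_of_optimal
    (hGZ : ∀ (N : ℕ) [NeZero N] (W : WeierstrassCurve ℚ) (K : Type) [Field K] [NumberField K],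
      gross_zagier N W K)
    (hKo : ∀ (N : ℕ) [NeZero N] (W : WeierstrassCurve ℚ) (K : Type) [Field K] [NumberField K],
      kolyvagin N W K)
    (hMN : ∀ (N : ℕ) [NeZero N] (W : WeierstrassCurve ℚ) (K : Type) [Field K] [NumberField K],
      MatarNekovar2019.thm03_padicValNat_card_sha_le_of_irreducible N W K)
    (hGZK : rank_eq_analyticRank_of_analyticRank_le_one) (hmod : hasEntireLFunction_rat)
    (hnf : exists_isNewformOf) (hFH : friedbergHoffstein_exists_heegnerField_split_twist_ne_zero)
    (hCM8 : bsdTriple_of_hasCM_of_L_one_ne_zero)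
    (hEdx : edixhoven_not_dvd_maninConstant_of_not_potentiallyGoodOrdinary)
    (hDeu : deuring_not_hasUnitRootAt_of_hasCM_of_not_cmSplit)
    (h : LowerHalfOnType p T)
    (W : WeierstrassCurve ℚ) [W.IsElliptic] [W.IsGloballyMinimal] [NeZero (W.conductorNorm ℤ)]
    (hT : HasSignedLocalType W p T) (hr : W.analyticRank = 1) (hp11 : 7 < p)
    (D : ModularParametrizationData W (W.conductorNorm ℤ))
    (hopt : ∀ z ∈ D.L.lattice, ∃ w ∈ periodLattice D.f, z = D.c * w) : BSDp W p :=
  bsdp_of_classX12_of_cmInert_of_optimal_of_lower hGZ hKo hMN hGZK hmod hnf hFH hCM8 hEdx hDeu W p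
    (classX12_of_hasSignedLocalType W p hT hr) hp11 (not_cmRamified_of_hasSignedLocalType W p hT)
    (not_cmSplit_of_hasSignedLocalType W p hT) D hopt (h W hT hr)

/-- Conversely the class target on a type is NECESSARY: `BSD(E,p)` at a pair gives its lower half
(`missingPPartAt_of_bsdp`; `Ш` finite by GZK `hGZK` in analytic rank one). So `LowerHalfOnType p T`
is EXACTLY "BSD_p for every rank-one CM curve of signed local type `(p, T)`" modulo the Manin datum
— the O10 residue per local type, neither weaker nor stronger. Bookkeeping.
[cite: Miller2011LMS, §1 and Def. 1.1] -/
theorem lowerHalfOnType_of_forall_bsdp (hGZK : rank_eq_analyticRank_of_analyticRank_le_one)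
    (h : ∀ (W : WeierstrassCurve ℚ) [W.IsElliptic] [W.IsGloballyMinimal],
      HasSignedLocalType W p T → W.analyticRank = 1 → BSDp W p) :
    LowerHalfOnType p T := fun W _ _ hT hr ↦ by
  haveI : Finite W.sha := (hGZK W (by rw [hr])).2
  exact (lower_and_upper_of_missingPPartAt W p (missingPPartAt_of_bsdp W p (h W hT hr))).1

end Consumers

/-! ### Withdrawn v1 declarations (append-only tombstones; do not use)

v1 of this file (p253350, same seat and generation) typed Rubin's criterion transposed to the
`η`-branch. After rmap-3 gen 7's correction (Burungale–Kobayashi–Nakamura–Ota 2025 Thm. 2.25/2.29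
prove the LOCAL half on `η`, preprint tier) the criterion has no role in any printed or announced
argument; the declarations are kept verbatim (tree rule: deprecate, don't mutate), their docstrings marked
WITHDRAWN, the `@[conjecture]` tag dropped from the criterion (it is no longer an obligation node of
the cell) and the unreferenced end consumer tagged `@[deprecated]`; the two finite-check predicates
remain meaningful as the typed form of the class folder's LUNIT / LOCDIV evidence columns but have
no kernel consumer. -/

section Withdrawn

/-- WITHDRAWN (v2; see the module docstring) — `(R1_η)` shadow, a unit-`L`-value witness of type
`(p, T)`: some CM curve `W'/ℚ` (globally minimal model) of signed local type `(p, T)` with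
`r_an(W') = 0` and `ord_p #Ш(W')_an = 0` (for a CM curve at `p ≥ 5`, `#W'(ℚ)_tors` and `∏_ℓ c_ℓ`
are prime to `p`, so: `L(W',1)/Ω_{W'}` a `p`-adic unit) — the transposition to type `(p, T)` of
Rubin's `p ∈ 𝒫_+` [§8 p. 418], which Rubin needed only for Conjecture 2.2 on the `ω`-branch. Kept as
the typed form of x1b gen 24's LUNIT evidence column; no kernel consumer. A predicate; nothing
asserted. [cite: Rubin1987LocalUnits, §8 (p. 418), definition of 𝒫₊] [cite: Miller2011LMS, Def. 1.1] -/
def UnitLValueWitness (p : ℕ) [Fact p.Prime] (T : KodairaSymbol) : Prop :=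
  ∃ (W' : WeierstrassCurve ℚ) (_ : W'.IsElliptic) (_ : W'.IsGloballyMinimal),
    HasSignedLocalType W' p T ∧ W'.analyticRank = 0 ∧
      ∃ q : ℚ, shaAn W' = (q : ℂ) ∧ padicValRat p q = 0

/-- WITHDRAWN (v2; see the module docstring) — `(R2_η)` shadow, bottom layer: some CM curve `W''/ℚ`
(globally minimal model) of signed local type `(p, T)` with `r_an(W'') = 1` and a rational point `P`
of infinite order whose image in `W''(ℚ_p)` (tree `WeierstrassCurve.toPadicPoint`) is not divisible
by `p` — the bottom-layer transposition of Rubin's `p ∈ 𝒫_−` ("the Heegner point `y ∉ pE(Φ)`",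
[§8 p. 418]; Rubin's proof uses a norm-compatible tower built from `y` by Prop. 6.1, `a_p = 0`,
level prime to `p` [p. 415, p. 417 Remark]). Kept as the typed form of x1b gen 24's LOCDIV evidence
column; no kernel consumer. A predicate; nothing asserted.
[cite: Rubin1987LocalUnits, §8 (p. 418), definition of 𝒫₋; §6 Prop. 6.1 (p. 415); §7 Remark (p. 417)] -/
def IndivisiblePointWitness (p : ℕ) [Fact p.Prime] (T : KodairaSymbol) : Prop :=
  ∃ (W'' : WeierstrassCurve ℚ) (_ : W''.IsElliptic) (_ : W''.IsGloballyMinimal),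
    HasSignedLocalType W'' p T ∧ W''.analyticRank = 1 ∧
      ∃ P : W''.toAffine.Point, ¬ IsOfFinAddOrder P ∧
        ∀ Q : (W''.baseChange ℚ_[p]).toAffine.Point, p • Q ≠ W''.toPadicPoint p P

/-- WITHDRAWN (v2; see the module docstring) — v1's criterion-shaped FORMULATION "both witnesses of
type `(p, T)` ⇒ `LowerHalfOnType p T`", the transposition of Rubin 1987 Thm. 8.4 [p. 418:
`p ∈ 𝒫_+ ∩ 𝒫_− ⇒` Conjecture 2.2, `ω`-eigenspace, curves good at `p ≥ 5`] composed with the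
`η`-branch steps. MOOT: the local half it was meant to reach is Burungale–Kobayashi–Nakamura–Ota
2025 Thm. 2.25/2.29 (preprint); no printed or announced argument for the global half consumes such
witnesses. As a statement it is implied by `LowerHalfOnType p T` (hence harmless); it is no longer
an obligation node of the cell. Nothing asserted. [cite: Rubin1987LocalUnits, Thm. 8.4 (p. 418)]
[claim: BurungaleKobayashiNakamuraOta2025, status: under-review] -/
def RubinEtaCriterionAt (p : ℕ) [Fact p.Prime] (T : KodairaSymbol) : Prop :=
  UnitLValueWitness p T → IndivisiblePointWitness p T → LowerHalfOnType p T

variable {p : ℕ} [hp : Fact p.Prime] {T : KodairaSymbol}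

/-- WITHDRAWN (v2) — modus ponens for the withdrawn criterion. Bookkeeping.
[cite: Rubin1987LocalUnits, Thm. 8.4 (p. 418)] -/
theorem lowerHalfOnType_of_rubinEtaCriterionAt (h : RubinEtaCriterionAt p T)
    (hplus : UnitLValueWitness p T) (hminus : IndivisiblePointWitness p T) : LowerHalfOnType p T :=
  h hplus hminus

/-- WITHDRAWN (v2) — v1's end-to-end consumer of the withdrawn criterion (`BSD(E,p)` for every
rank-one CM curve of the type, modulo the Manin datum). Superseded by `bsdp_of_lowerHalfOnType`.
[cite: MatarNekovar2019, Thm. 0.3 and §0.11] [cite: Miller2011LMS, §1 and Def. 1.1] -/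
@[deprecated "withdrawn (v2): use bsdp_of_lowerHalfOnType" (since := "2026-08-21")]
theorem bsdp_of_rubinEtaCriterionAt_of_witnesses
    (hGZ : ∀ (N : ℕ) [NeZero N] (W : WeierstrassCurve ℚ) (K : Type) [Field K] [NumberField K],
      gross_zagier N W K)
    (hKo : ∀ (N : ℕ) [NeZero N] (W : WeierstrassCurve ℚ) (K : Type) [Field K] [NumberField K],
      kolyvagin N W K)
    (hMN : ∀ (N : ℕ) [NeZero N] (W : WeierstrassCurve ℚ) (K : Type) [Field K] [NumberField K],
      MatarNekovar2019.thm03_padicValNat_card_sha_le_of_irreducible N W K)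
    (hGZK : rank_eq_analyticRank_of_analyticRank_le_one) (hmod : hasEntireLFunction_rat)
    (hnf : exists_isNewformOf) (hFH : friedbergHoffstein_exists_heegnerField_split_twist_ne_zero)
    (hCM8 : bsdTriple_of_hasCM_of_L_one_ne_zero)
    (hcrit : RubinEtaCriterionAt p T) (hplus : UnitLValueWitness p T)
    (hminus : IndivisiblePointWitness p T)
    (W : WeierstrassCurve ℚ) [W.IsElliptic] [W.IsGloballyMinimal] [NeZero (W.conductorNorm ℤ)]
    (hT : HasSignedLocalType W p T) (hr : W.analyticRank = 1) (hp5 : 5 ≤ p)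
    (D : ModularParametrizationData W (W.conductorNorm ℤ)) (hc : ¬ (p : ℤ) ∣ D.c) : BSDp W p :=
  bsdp_of_lowerHalfOnType hGZ hKo hMN hGZK hmod hnf hFH hCM8
    (lowerHalfOnType_of_rubinEtaCriterionAt hcrit hplus hminus) W hT hr hp5 D hc

end Withdrawn

end Summit.BirchSwinnertonDyer.Rank1Residual.X12.O10

end
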